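import Summits.BirchSwinnertonDyer.Rank1Residual.P2.CongruentNumberPairsAtTwoEvenPairTable
import Summits.BirchSwinnertonDyer.Rank1Residual.P2.CongruentNumberEvenFiveFamilyDescent
import Literature.NumberTheory.EllipticCurves.CongruentNumberEvenMonskySelmerExact
import Literature.NumberTheory.EllipticCurves.Wiles2000CongruentProofs
import HarnessLib

/-!
# Cell `bsd-monsky` (prover-A): the EXACT `2`-Selmer count `#Sel⁽²⁾(E_{2pq}/ℚ) = 8` on the WHOLE even-five
# two-prime family, and its unconditional consequence «`2pq` is congruent ⟺ `Ш(E_{2pq})[2] = 0`»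

HONEST FRAMING (cell `bsd-monsky`, run/shared/lean/pub/bsd-monsky/; README §1): ONE theorem on ONE explicit infinite
family of quadratic twists of the congruent number curve at the prime `2`; nothing is booked by this file. Everything
here is UNCONDITIONAL (axioms standard): no display, no named fact, no GZK.

WHAT IT DOES. Monsky's `2`-Selmer formula (appendix to Heath-Brown, Invent. Math. 118 (1994)) is a theorem of the tree
WITH EQUALITY (`CongruentNumberEvenMonskySelmerExact.card_selmerGroup_two_eq_pow`: `#Sel⁽²⁾(E_{2p₁⋯p_k}/ℚ) = 2^{2+s}`,
`s = 2k − rank_{𝔽₂} M`), and on the pairs `p ≡ 5 (mod 8)`, `q ≡ 3 (mod 4)` the rank of Monsky's `4 × 4` matrix is `3`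
in all four symbol cells (`P2.monskySelmerRankEven_five_pair`: `s(2pq) = 1`, both signs of `(p/q)`). Hence
`#Sel⁽²⁾(E_{2pq}/ℚ) = 8` EXACTLY — the count that Monsky 1990 Cor. 5.15 (2′) / Remark (2) prints («`S̄ = ℤ/2`») and
that Aoki 1999 Thm. 2.2 and Lagrange 1975 §11 corroborate, now a kernel theorem on the whole family (the bound `≤ 8` of
`CongruentNumberEvenFiveSelmerBound*.lean` was the load-bearing half; this is the other half). With Silverman's descent
count `#Sel⁽²⁾ = 2^{rk}·#E(ℚ)[2]·#(Ш ⊓ H¹[2])` (tree theorem `natCard_selmerGroup_eq`, Thm. X.4.2) and `#E_{2pq}(ℚ)[2] = 4`: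
`2^{rk}·#Ш(E_{2pq})[2] = 2`, so EXACTLY ONE of the following holds, unconditionally, for every pair of the family:
`rk = 1 ∧ Ш[2] = 0`, or `rk = 0 ∧ #Ш[2] = 2`. In words: **`2pq` is a congruent number if and only if `Ш(E_{2pq})[2] = 0`,
if and only if `Ш(E_{2pq})[2^∞] = 0`; and a non-congruent member of the family would have `Ш[2]` of order exactly `2`.**
(On `𝒮⁻` rank one is a theorem relative to the CM-point display, `P2/…RankDescent.lean`; on `𝒮⁺` relative to
{TYZ data, GZK}; the equivalence here needs neither.)
[cite: HeathBrown1994SelmerCongruentII, Appendix (Monsky), typescript p. 41 L1–L36; §1 p. 1 L14–L20]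
[cite: Monsky1990MockHeegner, Cor. 5.15 (2′) (p. 66), Remark (2) (p. 67)] [cite: SilvermanAEC2009, Thm. X.4.2]
[cite: TopYui2008Congruent, Prop. 3.3 (i) ⟺ (iv)]
-/

noncomputable section

open scoped Classical

open WeierstrassCurve Literature.NumberTheory.EllipticCurves
  Literature.NumberTheory.EllipticCurves.HeathBrown1994

set_option autoImplicit false

namespace Summit.BirchSwinnertonDyer.Rank1Residual.P2

variable {p q : ℕ}

/-! ## §1 The exact count -/

/-- **`#Sel⁽²⁾(E_{2pq}/ℚ) = 8` for ALL primes `p ≡ 5 (mod 8)`, `q ≡ 3 (mod 4)`, both signs of `(p/q)`** — Monsky's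
formula with equality (`card_selmerGroup_two_eq_pow`) at `k = 2` with `s(2pq) = 1` (`monskySelmerRankEven_five_pair`).
Unconditional. [cite: HeathBrown1994SelmerCongruentII, Appendix (Monsky), typescript p. 41 L1–L36]
[cite: Monsky1990MockHeegner, Cor. 5.15 (2′) (p. 66)] -/
theorem card_selmerGroup_two_eq_eight_two_mul_five_mul (hp : p.Prime) (hq : q.Prime) (hp5 : p % 8 = 5)
    (hq4 : q % 4 = 3) : Nat.card ((congruentNumberCurve (2 * (p * q))).selmerGroup 2) = 8 := by
  have hne : p ≠ q := fun h => by omega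
  have hprime : ∀ i, (![p, q] i).Prime := fun i => by fin_cases i <;> assumption
  have h2 : ∀ i, (![p, q] i) ≠ 2 := by
    intro i
    fin_cases i
    · show p ≠ 2
      omega
    · show q ≠ 2
      omega
  have hinj : Function.Injective ![p, q] := by
    intro i j hij
    fin_cases i <;> fin_cases j
    · rfl
    · exact absurd hij hne
    · exact absurd hij.symm hne
    · rfl
  have h := CongruentNumberEvenMonskySelmerExact.card_selmerGroup_two_eq_pow hprime h2 hinj
  rw [Fin.prod_univ_two] at h
  simp only [Matrix.cons_val_zero, Matrix.cons_val_one] at h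
  rw [monskySelmerRankEven_five_pair hp hq hp5 hq4] at h
  exact h

/-! ## §2 The descent count: `2^{rk}·#Ш[2] = 2` -/

/-- **The descent count on the family: `2^{rk E_{2pq}(ℚ)} · #(Ш(E_{2pq}) ⊓ H¹(ℚ,E)[2]) = 2`** (Silverman X.4.2 with
`#Sel₂ = 8`, `#E(ℚ)[2] = 4`). Unconditional. [cite: SilvermanAEC2009, Thm. X.4.2] -/
theorem two_pow_mordellWeilRank_mul_card_sha_inf_torsionBy_two (hp : p.Prime) (hq : q.Prime) (hp5 : p % 8 = 5)
    (hq4 : q % 4 = 3) :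
    haveI := isElliptic_congruentNumberCurve (n := 2 * (p * q)) (Nat.mul_ne_zero two_ne_zero (Nat.mul_ne_zero hp.ne_zero hq.ne_zero))
    2 ^ (congruentNumberCurve (2 * (p * q))).mordellWeilRank *
      Nat.card ((congruentNumberCurve (2 * (p * q))).sha ⊓
        AddSubgroup.torsionBy (congruentNumberCurve (2 * (p * q))).galH1 ((2 : ℕ) : ℤ) :
          AddSubgroup (congruentNumberCurve (2 * (p * q))).galH1) = 2 := by
  have hN : 2 * (p * q) ≠ 0 := Nat.mul_ne_zero two_ne_zero (Nat.mul_ne_zero hp.ne_zero hq.ne_zero)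
  haveI := isElliptic_congruentNumberCurve hN
  have hcard := (congruentNumberCurve (2 * (p * q))).natCard_selmerGroup_eq (n := 2) two_ne_zero
  have hsel : Nat.card ((congruentNumberCurve (2 * (p * q))).selmerGroup ((2 : ℕ) : ℤ)) = 8 := by
    simpa only [Nat.cast_ofNat] using card_selmerGroup_two_eq_eight_two_mul_five_mul hp hq hp5 hq4
  rw [hsel] at hcard
  have hT : Nat.card (AddSubgroup.torsionBy (congruentNumberCurve (2 * (p * q))).toAffine.Point
      ((2 : ℕ) : ℤ)) = 4 := by
    convert Smith2016.natCard_torsionBy_two_congruentNumberCurve hN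
    norm_num
  -- the torsion factor carries whichever `DecidableEq ℚ` instance the generic count was elaborated with;
  -- `convert` bridges the two (a `Subsingleton`)
  have h4 : (2 ^ (congruentNumberCurve (2 * (p * q))).mordellWeilRank *
      Nat.card ((congruentNumberCurve (2 * (p * q))).sha ⊓
        AddSubgroup.torsionBy (congruentNumberCurve (2 * (p * q))).galH1 ((2 : ℕ) : ℤ) :
          AddSubgroup (congruentNumberCurve (2 * (p * q))).galH1)) * 4 = 8 := by
    calc (2 ^ (congruentNumberCurve (2 * (p * q))).mordellWeilRank *
          Nat.card ((congruentNumberCurve (2 * (p * q))).sha ⊓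
            AddSubgroup.torsionBy (congruentNumberCurve (2 * (p * q))).galH1 ((2 : ℕ) : ℤ) :
              AddSubgroup (congruentNumberCurve (2 * (p * q))).galH1)) * 4 =
        2 ^ (congruentNumberCurve (2 * (p * q))).mordellWeilRank *
          Nat.card (AddSubgroup.torsionBy (congruentNumberCurve (2 * (p * q))).toAffine.Point
            ((2 : ℕ) : ℤ)) *
          Nat.card ((congruentNumberCurve (2 * (p * q))).sha ⊓
            AddSubgroup.torsionBy (congruentNumberCurve (2 * (p * q))).galH1 ((2 : ℕ) : ℤ) :
              AddSubgroup (congruentNumberCurve (2 * (p * q))).galH1) := by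
          rw [hT]; ring
      _ = 8 := by convert hcard.symm
  exact Nat.eq_of_mul_eq_mul_right (by norm_num : 0 < 4) (h4.trans (by norm_num))

/-- The two alternatives: `rk = 1 ∧ #Ш[2] = 1` or `rk = 0 ∧ #Ш[2] = 2` (from `2^{rk}·#Ш[2] = 2`). Unconditional.
[cite: SilvermanAEC2009, Thm. X.4.2] -/
theorem mordellWeilRank_card_sha_inf_torsionBy_two_cases (hp : p.Prime) (hq : q.Prime) (hp5 : p % 8 = 5)
    (hq4 : q % 4 = 3) :
    haveI := isElliptic_congruentNumberCurve (n := 2 * (p * q)) (Nat.mul_ne_zero two_ne_zero (Nat.mul_ne_zero hp.ne_zero hq.ne_zero))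
    ((congruentNumberCurve (2 * (p * q))).mordellWeilRank = 1 ∧
      Nat.card ((congruentNumberCurve (2 * (p * q))).sha ⊓
        AddSubgroup.torsionBy (congruentNumberCurve (2 * (p * q))).galH1 ((2 : ℕ) : ℤ) :
          AddSubgroup (congruentNumberCurve (2 * (p * q))).galH1) = 1) ∨
    ((congruentNumberCurve (2 * (p * q))).mordellWeilRank = 0 ∧
      Nat.card ((congruentNumberCurve (2 * (p * q))).sha ⊓
        AddSubgroup.torsionBy (congruentNumberCurve (2 * (p * q))).galH1 ((2 : ℕ) : ℤ) :
          AddSubgroup (congruentNumberCurve (2 * (p * q))).galH1) = 2) := by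
  have hN : 2 * (p * q) ≠ 0 := Nat.mul_ne_zero two_ne_zero (Nat.mul_ne_zero hp.ne_zero hq.ne_zero)
  haveI := isElliptic_congruentNumberCurve hN
  have h := two_pow_mordellWeilRank_mul_card_sha_inf_torsionBy_two hp hq hp5 hq4
  generalize (congruentNumberCurve (2 * (p * q))).mordellWeilRank = r at h ⊢
  generalize Nat.card ((congruentNumberCurve (2 * (p * q))).sha ⊓
        AddSubgroup.torsionBy (congruentNumberCurve (2 * (p * q))).galH1 ((2 : ℕ) : ℤ) :
          AddSubgroup (congruentNumberCurve (2 * (p * q))).galH1) = S at h ⊢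
  rcases Nat.lt_or_ge r 2 with hr | hr
  · interval_cases r
    · right
      refine ⟨rfl, ?_⟩
      norm_num at h
      omega
    · left
      refine ⟨rfl, ?_⟩
      norm_num at h
      omega
  · exfalso
    have hS : 1 ≤ S := Nat.pos_of_ne_zero (by rintro rfl; simp at h)
    have h4 : 4 ≤ 2 ^ r := by
      calc 4 = 2 ^ 2 := by norm_num
        _ ≤ 2 ^ r := Nat.pow_le_pow_right (by norm_num) hr
    have := Nat.mul_le_mul h4 hS
    omega

/-! ## §3 Rank one ⟺ `Ш[2] = 0` ⟺ `2pq` congruent -/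

/-- **`rk E_{2pq}(ℚ) = 1 ⟺ Ш(E_{2pq})[2] = 0`** on the whole family. Unconditional. [cite: SilvermanAEC2009, Thm. X.4.2] -/
theorem mordellWeilRank_eq_one_iff_sha_inf_torsionBy_two_eq_bot (hp : p.Prime) (hq : q.Prime) (hp5 : p % 8 = 5)
    (hq4 : q % 4 = 3) :
    haveI := isElliptic_congruentNumberCurve (n := 2 * (p * q)) (Nat.mul_ne_zero two_ne_zero (Nat.mul_ne_zero hp.ne_zero hq.ne_zero))
    (congruentNumberCurve (2 * (p * q))).mordellWeilRank = 1 ↔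
      ((congruentNumberCurve (2 * (p * q))).sha ⊓
        AddSubgroup.torsionBy (congruentNumberCurve (2 * (p * q))).galH1 ((2 : ℕ) : ℤ) :
          AddSubgroup (congruentNumberCurve (2 * (p * q))).galH1) = ⊥ := by
  have hN : 2 * (p * q) ≠ 0 := Nat.mul_ne_zero two_ne_zero (Nat.mul_ne_zero hp.ne_zero hq.ne_zero)
  haveI := isElliptic_congruentNumberCurve hN
  rcases mordellWeilRank_card_sha_inf_torsionBy_two_cases hp hq hp5 hq4 with ⟨hr, hS⟩ | ⟨hr, hS⟩
  · exact ⟨fun _ => AddSubgroup.eq_bot_of_card_eq _ hS, fun _ => hr⟩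
  · refine ⟨fun h => by omega, fun h => ?_⟩
    rw [h, AddSubgroup.card_bot] at hS
    omega

/-- **`2pq` is a congruent number ⟺ `Ш(E_{2pq})[2] = 0`** for all primes `p ≡ 5 (mod 8)`, `q ≡ 3 (mod 4)`, either
sign of `(p/q)`: a congruent number has `rk ≠ 0` (Top–Yui), i.e. `rk = 1` here, i.e. `Ш[2] = 0`. Unconditional.
[cite: TopYui2008Congruent, Prop. 3.3 (i) ⟺ (iv)] [cite: SilvermanAEC2009, Thm. X.4.2] -/
theorem isCongruentNumber_iff_sha_inf_torsionBy_two_eq_bot (hp : p.Prime) (hq : q.Prime) (hp5 : p % 8 = 5)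
    (hq4 : q % 4 = 3) :
    haveI := isElliptic_congruentNumberCurve (n := 2 * (p * q)) (Nat.mul_ne_zero two_ne_zero (Nat.mul_ne_zero hp.ne_zero hq.ne_zero))
    IsCongruentNumber (2 * (p * q)) ↔
      ((congruentNumberCurve (2 * (p * q))).sha ⊓
        AddSubgroup.torsionBy (congruentNumberCurve (2 * (p * q))).galH1 ((2 : ℕ) : ℤ) :
          AddSubgroup (congruentNumberCurve (2 * (p * q))).galH1) = ⊥ := by
  have hN : 0 < 2 * (p * q) := Nat.pos_of_ne_zero (Nat.mul_ne_zero two_ne_zero (Nat.mul_ne_zero hp.ne_zero hq.ne_zero))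
  haveI := isElliptic_congruentNumberCurve hN.ne'
  rw [← Wiles2000.mordellWeilRank_ne_zero_iff_isCongruentNumber hN,
    ← mordellWeilRank_eq_one_iff_sha_inf_torsionBy_two_eq_bot hp hq hp5 hq4]
  rcases mordellWeilRank_card_sha_inf_torsionBy_two_cases hp hq hp5 hq4 with ⟨hr, -⟩ | ⟨hr, -⟩ <;>
    simp [hr]

/-- **`2pq` is a congruent number ⟺ `Ш(E_{2pq})[2^∞] = 0`** (the `2`-primary part): `Ш[2] = 0` kills the `2`-primary
part, and conversely a `2`-torsion element of `Ш` lies in the `2`-primary part. Unconditional.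
[cite: TopYui2008Congruent, Prop. 3.3 (i) ⟺ (iv)] [cite: SilvermanAEC2009, Thm. X.4.2] -/
theorem isCongruentNumber_iff_primaryComponent_sha_two_eq_bot (hp : p.Prime) (hq : q.Prime) (hp5 : p % 8 = 5)
    (hq4 : q % 4 = 3) :
    haveI := isElliptic_congruentNumberCurve (n := 2 * (p * q)) (Nat.mul_ne_zero two_ne_zero (Nat.mul_ne_zero hp.ne_zero hq.ne_zero))
    IsCongruentNumber (2 * (p * q)) ↔
      AddCommGroup.primaryComponent (congruentNumberCurve (2 * (p * q))).sha 2 = ⊥ := by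
  have hN : 2 * (p * q) ≠ 0 := Nat.mul_ne_zero two_ne_zero (Nat.mul_ne_zero hp.ne_zero hq.ne_zero)
  haveI := isElliptic_congruentNumberCurve hN
  haveI : Fact (Nat.Prime 2) := ⟨Nat.prime_two⟩
  rw [isCongruentNumber_iff_sha_inf_torsionBy_two_eq_bot hp hq hp5 hq4]
  refine ⟨fun h => primaryComponent_sha_eq_bot_of_inf_torsionBy_eq_bot _ 2 h, fun h => ?_⟩
  rw [eq_bot_iff]
  intro x hx
  obtain ⟨hxsha, hx2⟩ := AddSubgroup.mem_inf.mp hx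
  have h2 : (2 : ℕ) • x = 0 := AddSubgroup.torsionBy.nsmul_iff.mp hx2
  set y : (congruentNumberCurve (2 * (p * q))).sha := ⟨x, hxsha⟩ with hy
  have hy2 : (2 : ℕ) • y = 0 := by
    apply Subtype.ext
    rw [AddSubgroupClass.coe_nsmul, ZeroMemClass.coe_zero]
    exact h2
  have hmem : y ∈ AddCommGroup.primaryComponent (congruentNumberCurve (2 * (p * q))).sha 2 := by
    rw [AddCommGroup.mem_primaryComponent]
    exact ⟨1, by rw [pow_one]; exact hy2⟩
  rw [h, AddSubgroup.mem_bot] at hmem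
  have : x = 0 := congrArg Subtype.val hmem
  rw [this]
  exact AddSubgroup.zero_mem _

/-- **A non-congruent member of the family would have `Ш(E_{2pq})[2]` of order exactly `2`** (and rank `0`):
the other branch of the descent count. Unconditional; no such member is expected (root number `−1`, BSD).
[cite: SilvermanAEC2009, Thm. X.4.2] [cite: TopYui2008Congruent, Prop. 3.3 (i) ⟺ (iv)] -/
theorem card_sha_inf_torsionBy_two_eq_two_of_not_isCongruentNumber (hp : p.Prime) (hq : q.Prime)
    (hp5 : p % 8 = 5) (hq4 : q % 4 = 3) (h : ¬ IsCongruentNumber (2 * (p * q))) :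
    haveI := isElliptic_congruentNumberCurve (n := 2 * (p * q)) (Nat.mul_ne_zero two_ne_zero (Nat.mul_ne_zero hp.ne_zero hq.ne_zero))
    (congruentNumberCurve (2 * (p * q))).mordellWeilRank = 0 ∧
      Nat.card ((congruentNumberCurve (2 * (p * q))).sha ⊓
        AddSubgroup.torsionBy (congruentNumberCurve (2 * (p * q))).galH1 ((2 : ℕ) : ℤ) :
          AddSubgroup (congruentNumberCurve (2 * (p * q))).galH1) = 2 := by
  have hN : 2 * (p * q) ≠ 0 := Nat.mul_ne_zero two_ne_zero (Nat.mul_ne_zero hp.ne_zero hq.ne_zero)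
  haveI := isElliptic_congruentNumberCurve hN
  rcases mordellWeilRank_card_sha_inf_torsionBy_two_cases hp hq hp5 hq4 with ⟨hr, hS⟩ | hcase
  · exact absurd ((mordellWeilRank_eq_one_iff_sha_inf_torsionBy_two_eq_bot hp hq hp5 hq4).mp hr)
      (fun hb => h ((isCongruentNumber_iff_sha_inf_torsionBy_two_eq_bot hp hq hp5 hq4).mpr hb))
  · exact hcase

end Summit.BirchSwinnertonDyer.Rank1Residual.P2

end
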